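import Summits.HodgeConjecture.CorCM.HypLiu418.A3Liu418GSThmD6OneCurve
import Summits.HodgeConjecture.HodgeCM.Model.GSAdaptedFrame
import Literature.NumberTheory.Automorphic.Liu2021.Def411WeilCarriersAtLineFrameTransport
import HarnessLib

/-!
# The face transport at the GS face: `Ψ : ω_face(ν,ε,χ) ≃ ω_{D′}(ν,ε′,χ′)` from frame independence of the χ-attached Weil representation

For the adapted frame `D′ = B·(g⋆ ⊕ 1)` of a split hermitian 3-space `ᵗ(cB)(a′H_V)B = J⋆ ⊕ J⊥`
(`UnitaryShimuraCurveGSAdaptedFrame`: `gsAdaptedFrame`, `gsAdaptedDiag = dJ ‖ a′⁻¹J⊥₀₀`, `gsAdaptedTransport = ι_{D′}`), frame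
independence of the χ-attached finite Weil representation (`chiSplittingFrameTransport`, consumed through
`exists_omegaAtLine_equiv_of_chiSplittingFrameTransport` at the comparison isometry `D′⁻¹ · frameG V`) gives a `𝔾(𝔸_F^∞)`-equivariant
`ℂ`-linear isomorphism `Ψ` between the face model `UV` (at the fixed rational frame `(frameD V, ιVE V)` of `V`) and the face model
`UVat` at `(gsAdaptedDiag, gsAdaptedTransport)` (`A3Liu418GSThmD6OneCurve.UVat`), at the label `ε = (UV …).epsOf e` (every admissible
label is of this form) and `χ′ = ⟨χ.1, χ.2⟩` — exactly the `(ε′, χ′, Ψ, hΨ)` binders of `DecompositionAtFaceAdapted`.  The model-frame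
junction is `HodgeCM.Model.GSAdaptedFrame.gsAdaptedTransport_eq_finAdelicCongr_finFrameCongr` (`ι_{D′} = finAdelicCongr (D′⁻¹g₀) ∘ ιVE V`).

* `rFace`, `faceLine` — the face family's Weil line datum `r_a` and the face line `a₀(e) = r_a(epsOf (−e))`, the common spelling of
  `(r_a).toFun ((UV …).epsOf e)` and `(r_a).toFun ((UVat …).epsOf e)`;
* **`exists_faceTransport_of_stubT (hT : chiSplittingFrameTransport) … : ∃ Ψ, … ∀ g x, Ψ (ρ g x) = ρ′ g (Ψ x)`**.

## References
* [Liu2021] Y. Liu, Camb. J. Math. 9 (2021) = arXiv:2102.11518: Def. 4.11 (l. 2092–2096), Def. 4.12 (l. 2102–2111); App. D §D.1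
  Step 2 (l. 5219); Thm. 4.15 proof l. 2193–2203.
* [MoeglinVignerasWaldspurger1987] C. Mœglin, M.-F. Vignéras, J.-L. Waldspurger, *Correspondances de Howe sur un corps p-adique*,
  LNM 1291, Chap. 2 II.1.
* [PlatonovRapinchuk1994] V. Platonov, A. Rapinchuk, *Algebraic Groups and Number Theory*, §2.3.
-/

set_option autoImplicit false

noncomputable section

open scoped TensorProduct Matrix NumberField
open NumberField
open Summit.HodgeConjecture.CorCM.Model
open Literature.AlgebraicGeometry.Motives (CMType)
open Literature.AlgebraicGeometry.ShimuraVarieties.UnitaryCanonicalModel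
open Literature.NumberTheory.Automorphic Literature.NumberTheory.Automorphic.UnitaryGroup
open Literature.NumberTheory.Automorphic.IdeleClassGroup
open Literature.NumberTheory.Automorphic.Liu2021 Literature.NumberTheory.Automorphic.Liu2021.AppendixC
open Literature.NumberTheory.GelbartRogawski1991 Literature.NumberTheory.GelbartRogawski1991.UnitaryDualPair
open Literature.NumberTheory.GaloisRepresentations
open Literature.RepresentationTheory.Liu2021
open Literature.RepresentationTheory.HarrisKudlaSweet1996
open Literature.NumberTheory.Weil1964
open Literature.NumberTheory.GelbartRogawski1991.UnitaryDualPair.WeilCoinv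
open Literature.NumberTheory.GelbartRogawski1991.UnitaryDualPair.LocalSplitting
open Literature.NumberTheory.Automorphic.Liu2021.Def411WeilCarriersDoubling
open Literature.NumberTheory.Automorphic.Liu2021.Def411WeilCarriers (TW JW JW_eq isSymm_TW isUnit_det_TW Rep Eps epsOf Chi locF
  omegaAtLine rhoVAtLine rhoAtLine)
open HodgeCM.Model HodgeCM.Model.LiuIndex
open Summit.HodgeConjecture.CorCM.Transposition.OmegaTransport (realUnit)
open HodgeCM.Model.ArchSideTerm (e₁)
open Summit.HodgeConjecture.CorCM.D2Bridge.AdapterMuConj (muConj)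


namespace Summit.HodgeConjecture.CorCM.Lines.A3Liu418

/-- the face family's Weil line datum `r_a` at `V`'s scalar `a` (the `(fun _ _ => Rep.update …)` of `UV`, beta-reduced).
[cite: Liu2021, Def. 4.11 (l. 2092–2096)] -/
abbrev rFace (F : HodgeCM.CMField) (a : HodgeCM.Model.LiuIndex.RealScalar F) :
    Rep ↥(maximalRealSubfield (HodgeCM.CMField.K F)) (imagUnitSq (HodgeCM.CMField.K F)) :=
  Rep.update ↥(maximalRealSubfield (HodgeCM.CMField.K F)) (imagUnitSq (HodgeCM.CMField.K F)) (Rep.ofLineOf ↥(maximalRealSubfield (HodgeCM.CMField.K F)) (imagUnitSq (HodgeCM.CMField.K F))) (locF ↥(maximalRealSubfield (HodgeCM.CMField.K F)) (imagUnitSq (HodgeCM.CMField.K F)) (realUnit ⟨HodgeCM.CMField.K F⟩ a.1 a.2.1 a.2.2)) (realUnit ⟨HodgeCM.CMField.K F⟩ a.1 a.2.1 a.2.2) rfl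

/-- the face line `a₀(e) := r_a (classes of e/δ̄′)` — the COMMON spelling of `(r_a).toFun ((UV …).epsOf e)` and `(r_a).toFun ((UVat …).epsOf e)`.
[cite: Liu2021, Def. 4.12 (l. 2102–2111)] -/
abbrev faceLine (F : HodgeCM.CMField) (a : HodgeCM.Model.LiuIndex.RealScalar F) (e : (F : Type)) :
    (↥(maximalRealSubfield (HodgeCM.CMField.K F)))ˣ :=
  (rFace F a).toFun (Def411WeilCarriers.epsOf ↥(maximalRealSubfield (HodgeCM.CMField.K F)) (imagUnitSq (HodgeCM.CMField.K F))
    (HodgeCM.CMField.K F) (2 * imagUnit (HodgeCM.CMField.K F))⁻¹ (-e))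

set_option maxHeartbeats 800000 in -- measured (200 k, 400 k] at the 160 k-margin probe (A-p16 (g11), O5 2× envelope)
/-- **THE FACE TRANSPORT at the GS face**: for the adapted frame `D′ = B·(g⋆ ⊕ 1)` of the splitting `ᵗ(cB)(a′H_V)B = J⋆ ⊕ J⊥`,
frame independence of the χ-attached Weil representation (`chiSplittingFrameTransport`, consumed at `D′⁻¹·frameG V`) gives a
`𝔾(𝔸_F^∞)`-equivariant isomorphism `Ψ : ω_face(ν, ε, χ) ≃ ω_{D′}(ν, ε′, χ′)` between `UV` (frame `frameD V`) and `UVat` at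
`(dJ ‖ a′⁻¹J⊥₀₀, ι_{D′})`, at the label `ε = (UV …).epsOf e` (every admissible label is of this form) and `χ′ = ⟨χ.1, χ.2⟩` — exactly the
`(ε′, χ′, Ψ, hΨ)` binders of `DecompositionAtFaceAdapted`.
[cite: Liu2021, Def. 4.11 (l. 2092–2096); App. D §D.1 Step 2 (l. 5219)] [cite: MoeglinVignerasWaldspurger1987, Chap. 2 II.1]
[cite: PlatonovRapinchuk1994, §2.3] -/
theorem exists_faceTransport_of_stubT (hT : chiSplittingFrameTransport)
    (hDel : Literature.AlgebraicGeometry.ShimuraVarieties.UnitaryCanonicalModel.canonicalModel_exists_printed)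
    (F : HodgeCM.CMField) [IsGalois ℚ F] {ι₁ : F →+* ℂ} (V : HodgeCM.HermSpace3 F ι₁) (a : HodgeCM.Model.LiuIndex.RealScalar F)
    (Φ : CMType F)
    (ν : Literature.NumberTheory.Automorphic.IdeleClassGroup (F : Type) →ₜ* Circle) (hν : IdeleClassGroup.IsConjugateSymplectic (F : Type) ν)
    (Jstar : Matrix (Fin 2) (Fin 2) (F : Type)) (Jperp : Matrix (Fin 1) (Fin 1) (F : Type)) (B : GL (Fin 3) (F : Type))
    (a' : (F : Type)) (ha : a' ≠ 0)
    (hB : formCongr ((IsCMField.complexConj (F : Type) : (F : Type) ≃ₐ[↥(maximalRealSubfield (F : Type))] (F : Type)) :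
        (F : Type) →+* (F : Type)) B (a' • HodgeCM.HermSpace3.Hm V) = finSum 2 1 Jstar Jperp)
    (ha' : IsCMField.complexConj (F : Type) a' = a') (hJ : IsCMField.complexConj (F : Type) (Jperp 0 0) = Jperp 0 0)
    (hJ0 : Jperp 0 0 ≠ 0)
    (gstar : GL (Fin 2) (F : Type)) (dJ : Fin 2 → (F : Type)) (hdJ : ∀ i, IsCMField.complexConj (F : Type) (dJ i) = dJ i)
    (hdJ0 : ∀ i, dJ i ≠ 0)
    (hg : formCongr ((IsCMField.complexConj (F : Type) : (F : Type) ≃ₐ[↥(maximalRealSubfield (F : Type))] (F : Type)) :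
        (F : Type) →+* (F : Type)) gstar (a'⁻¹ • Jstar) = Matrix.diagonal dJ)
    (e : (F : Type)) (χ : (UV hDel F V a Φ).Chi) :
    ∃ Ψ : (UV hDel F V a Φ).omega ν hν ((UV hDel F V a Φ).epsOf e) χ ≃ₗ[ℂ]
        (UVat hDel F V a Φ (gsAdaptedDiag (F : Type) Jperp a' dJ) (gsAdaptedDiag_real (F : Type) Jperp dJ hdJ ha' hJ)
          (gsAdaptedDiag_ne (F : Type) Jperp ha dJ hdJ0 hJ0)
          (gsAdaptedTransport (F : Type) Jstar Jperp (HodgeCM.HermSpace3.Hm V) B ha hB gstar dJ hg)).omega ν hν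
          ((UVat hDel F V a Φ (gsAdaptedDiag (F : Type) Jperp a' dJ) (gsAdaptedDiag_real (F : Type) Jperp dJ hdJ ha' hJ)
            (gsAdaptedDiag_ne (F : Type) Jperp ha dJ hdJ0 hJ0)
            (gsAdaptedTransport (F : Type) Jstar Jperp (HodgeCM.HermSpace3.Hm V) B ha hB gstar dJ hg)).epsOf e) ⟨χ.1, χ.2⟩,
      ∀ (g : (CV hDel F V Φ).G) (x : (UV hDel F V a Φ).omega ν hν ((UV hDel F V a Φ).epsOf e) χ),
        Ψ ((UV hDel F V a Φ).rho ν hν ((UV hDel F V a Φ).epsOf e) χ g x) =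
          (UVat hDel F V a Φ (gsAdaptedDiag (F : Type) Jperp a' dJ) (gsAdaptedDiag_real (F : Type) Jperp dJ hdJ ha' hJ)
            (gsAdaptedDiag_ne (F : Type) Jperp ha dJ hdJ0 hJ0)
            (gsAdaptedTransport (F : Type) Jstar Jperp (HodgeCM.HermSpace3.Hm V) B ha hB gstar dJ hg)).rho ν hν
            ((UVat hDel F V a Φ (gsAdaptedDiag (F : Type) Jperp a' dJ) (gsAdaptedDiag_real (F : Type) Jperp dJ hdJ ha' hJ)
              (gsAdaptedDiag_ne (F : Type) Jperp ha dJ hdJ0 hJ0)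
              (gsAdaptedTransport (F : Type) Jstar Jperp (HodgeCM.HermSpace3.Hm V) B ha hB gstar dJ hg)).epsOf e) ⟨χ.1, χ.2⟩ g
            (Ψ x) := by
  -- frame independence at the comparison isometry `D′⁻¹ · frameG V`, the splitting character `χ_ν̄`, the face line `a₀(e)` and `χ`
  obtain ⟨Ψ, hΨ⟩ := exists_omegaAtLine_equiv_of_chiSplittingFrameTransport hT (F : Type) e₁ (frameD V) (frameD_real V) (frameD_ne V)
    (gsAdaptedDiag (F : Type) Jperp a' dJ) (gsAdaptedDiag_real (F : Type) Jperp dJ hdJ ha' hJ)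
    (gsAdaptedDiag_ne (F : Type) Jperp ha dJ hdJ0 hJ0)
    (gsFrameComparison (F : Type) B gstar (frameG V))
    (formCongr_gsFrameComparison (F : Type) Jstar Jperp (HodgeCM.HermSpace3.Hm V) B ha hB gstar dJ hg (frameG V) (frameD V)
      (frame_congr V))
    (toHeckeCharacter (F : Type) (galConj (IsCMField.complexConj (F : Type)) ν))
    (isUnitary_toHeckeCharacter (F : Type) (galConj (IsCMField.complexConj (F : Type)) ν))
    ((isOscillatorChar_toHeckeCharacter_iff (galConj (IsCMField.complexConj (F : Type)) ν)).mpr hν.galConj)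
    (faceLine F a e) ⟨χ.1, χ.2⟩
  refine ⟨Ψ, fun g x => ?_⟩
  have h := hΨ (ιVE V g) x
  rw [← gsAdaptedTransport_eq_finAdelicCongr_finFrameCongr (F : Type) Jstar Jperp (HodgeCM.HermSpace3.Hm V) B ha hB gstar dJ hg
    (frameG V) (frameD V) (frame_congr V) g] at h
  exact h

end Summit.HodgeConjecture.CorCM.Lines.A3Liu418

end
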